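import Literature.Analysis.FluidPDE.TaoClassGlue
import Literature.Analysis.FluidPDE.ClassicalSolutionRescale

/-!
# Crux `CertifiedBlowupAxisymBlowup` (stmt-NavierStokesRegularity-0727), line `compact-amplification`:
# time rescaling of Tao-class solutions

Theorems file (lands `--supports stmt-NavierStokesRegularity-0727`), a brick of the CONVERSE of the
line's transfer (crux ⇒ C⁺). The statement C⁺ (`stub_amplification`) asks for Tao-class solutions
on sub-slabs of the unit interval `[0, 1]`; a blow-up with lifespan `T > 1` is brought into this
format by the pure **time** rescaling

  `v(s, x) = c u(c s, x)`,  `q(s, x) = c² p(c s, x)`,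

which maps classical solutions with viscosity `ν` on `[0, T]` to classical solutions with viscosity
`c ν` on `[0, T / c]` (the case `α = β = c`, `γ = 1` of the tree's space–time rescaling covariance
`IsClassicalNSSolutionOn.stRescale`; Leray 1934, §20) and preserves Tao's smooth `H¹` class
(`isTaoSolutionOn_timeRescale`): all `L²` Sobolev norms of the slices scale by powers of `c`, the
one-sided time derivative within the slab by `c²` (`timeDerivWithin_smul_stPull`), and continuity in
`L²` is composed with `s ↦ c s`. No spatial change of variables is involved.

## References

* J. Leray, *Sur le mouvement d'un liquide visqueux emplissant l'espace*, Acta Math. 63 (1934), §20.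
* T. Tao, Anal. PDE 6 (2013) = arXiv:1108.1165, Thm. 5.4 and footnote 3.
-/

set_option linter.dupNamespace false

noncomputable section

open MeasureTheory Set Function Filter Topology
open scoped ENNReal NNReal ContDiff

namespace Summit.NavierStokesRegularity.NavierStokesRegularity.Theorems.CertifiedBlowupAxisymBlowup.CompactAmplification

open Literature.Analysis.FluidPDE

local notation "ℝ³" => EuclideanSpace ℝ (Fin 3)

/-- Scaling of the `L²` Sobolev seminorms of a slice: `∫ ‖Dⁿ(c • f)‖² = ‖c‖ₑ² ∫ ‖Dⁿ f‖²` for a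
`Cⁿ` field `f`. [folklore] -/
theorem lintegral_iteratedFDeriv_const_smul {F : Type*} [NormedAddCommGroup F] [NormedSpace ℝ F]
    {f : ℝ³ → F} {n : ℕ} (hf : ContDiff ℝ n f) (c : ℝ) :
    ∫⁻ x, ‖iteratedFDeriv ℝ n (c • f) x‖ₑ ^ 2 = ‖c‖ₑ ^ 2 * ∫⁻ x, ‖iteratedFDeriv ℝ n f x‖ₑ ^ 2 := by
  rw [← lintegral_const_mul' _ _ (by simp)]
  refine lintegral_congr fun x => ?_
  rw [iteratedFDeriv_const_smul_apply hf.contDiffAt, enorm_smul, mul_pow]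

/-- The bound form: if `∫ ‖Dⁿ f‖² ≤ C` then `∫ ‖Dⁿ(c • f)‖² ≤ ‖c‖₊² C`. [folklore] -/
theorem lintegral_iteratedFDeriv_const_smul_le {F : Type*} [NormedAddCommGroup F]
    [NormedSpace ℝ F] {f : ℝ³ → F} {n : ℕ} (hf : ContDiff ℝ n f) (c : ℝ) {C : ℝ≥0}
    (hC : ∫⁻ x, ‖iteratedFDeriv ℝ n f x‖ₑ ^ 2 ≤ C) :
    ∫⁻ x, ‖iteratedFDeriv ℝ n (c • f) x‖ₑ ^ 2 ≤ ((‖c‖₊ ^ 2 * C : ℝ≥0) : ℝ≥0∞) := by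
  rw [lintegral_iteratedFDeriv_const_smul hf c]
  calc ‖c‖ₑ ^ 2 * ∫⁻ x, ‖iteratedFDeriv ℝ n f x‖ₑ ^ 2 ≤ ‖c‖ₑ ^ 2 * (C : ℝ≥0∞) := by gcongr
    _ = ((‖c‖₊ ^ 2 * C : ℝ≥0) : ℝ≥0∞) := by
        rw [ENNReal.coe_mul, ENNReal.coe_pow, enorm_eq_nnnorm]

/-- **Time rescaling preserves Tao's smooth `H¹` class.** If `(u, p)` is a Tao-class solution with
viscosity `ν` on `[0, T]` from `u₀` (`T > 0`), then for `c > 0` the pair `v(s, x) = c u(c s, x)`,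
`q(s, x) = c² p(c s, x)` is a Tao-class solution with viscosity `c ν` on `[0, T / c]` from `c • u₀`:
it is classical by the space–time rescaling covariance with `α = β = c`, `γ = 1`
(`IsClassicalNSSolutionOn.stRescale`, Leray 1934, §20, no spatial scaling), its Sobolev norms and
those of `∂ₛv = c² (∂ₜu)(c s)` and of `q` are those of `u, ∂ₜu, p` times powers of `c`, and
`v ∈ C([0, T/c]; L²)` by composition with `s ↦ c s`. [cite: Leray1934, §20] -/
theorem isTaoSolutionOn_timeRescale :
    ∀ {T ν : ℝ} {u₀ : EuclideanSpace ℝ (Fin 3) → EuclideanSpace ℝ (Fin 3)}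
      {u : ℝ → EuclideanSpace ℝ (Fin 3) → EuclideanSpace ℝ (Fin 3)}
      {p : ℝ → EuclideanSpace ℝ (Fin 3) → ℝ}, IsTaoSolutionOn T ν u₀ u p → 0 < T →
      ∀ {c : ℝ}, 0 < c → IsTaoSolutionOn (T / c) (c * ν) (c • u₀) (fun s x => c • u (c * s) x)
        (fun s x => c ^ 2 * p (c * s) x) := by
  intro T ν u₀ u p h hT c hc
  have hc0 : c ≠ 0 := hc.ne'
  have hTc : 0 < T / c := div_pos hT hc
  have hU : UniqueDiffOn ℝ (Icc 0 T) := uniqueDiffOn_Icc hT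
  -- the affine preimage of the slab and the pulled-back fields
  have hS : ((fun r => (0 : ℝ) + c * r) ⁻¹' Icc 0 T) = Icc 0 (T / c) := by
    ext r
    simp only [mem_preimage, mem_Icc, zero_add]
    rw [le_div_iff₀ hc, mul_comm r c]
    constructor
    · rintro ⟨h1, h2⟩
      exact ⟨(mul_nonneg_iff_of_pos_left hc).1 h1, h2⟩
    · rintro ⟨h1, h2⟩
      exact ⟨mul_nonneg hc.le h1, h2⟩
  have hmem : ∀ {s : ℝ}, s ∈ Icc 0 (T / c) → c * s ∈ Icc 0 T := fun {s} hs => by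
    have h' : s ∈ (fun r => (0 : ℝ) + c * r) ⁻¹' Icc 0 T := by rw [hS]; exact hs
    simpa using h'
  have hu_eq : (c • stPull c 1 0 0 u) = fun s x => c • u (c * s) x := by
    funext s x
    simp [stPull_apply]
  have hp_eq : (c ^ 2 • stPull c 1 0 0 p) = fun s x => c ^ 2 * p (c * s) x := by
    funext s x
    simp [stPull_apply]
  -- classical, by the rescaling covariance with `α = β = c`, `γ = 1`
  have hcl : IsClassicalNSSolutionOn (Icc 0 (T / c)) (c * ν) 0 (fun s x => c • u (c * s) x)
      (fun s x => c ^ 2 * p (c * s) x) := by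
    have key := h.classical.stRescale hc one_pos (mul_one c).symm 0 0
    rw [hS, smul_stPull_zero, hu_eq, hp_eq, div_one] at key
    exact key
  -- the one-sided time derivative of the rescaled velocity
  have hdt : ∀ s (y : ℝ³), timeDerivWithin (Icc 0 (T / c)) (fun s x => c • u (c * s) x) s y =
      (c * c) • timeDerivWithin (Icc 0 T) u (c * s) y := by
    intro s y
    have h1 := timeDerivWithin_smul_stPull (Icc 0 T) u c hc0 1 0 (0 : ℝ³) s y
    rw [hS, hu_eq] at h1
    simpa using h1
  have hdt' : ∀ s, timeDerivWithin (Icc 0 (T / c)) (fun s x => c • u (c * s) x) s =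
      (c * c) • timeDerivWithin (Icc 0 T) u (c * s) := fun s => funext fun y => by
    rw [hdt s y]; rfl
  -- smoothness of the slices of `u`, `∂ₜu`, `p`
  have hsm_u : ∀ {t : ℝ}, t ∈ Icc 0 T → ∀ n : ℕ, ContDiff ℝ n (u t) := fun ht n =>
    (h.classical.contDiff_velocity ht).of_le (mod_cast le_top)
  have hsm_dt : ∀ {t : ℝ}, t ∈ Icc 0 T → ∀ n : ℕ,
      ContDiff ℝ n (timeDerivWithin (Icc 0 T) u t) := fun ht n =>
    ((h.classical.smooth_velocity.timeDerivWithin hU).contDiff_slice ht).of_le (mod_cast le_top)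
  have hsm_p : ∀ {t : ℝ}, t ∈ Icc 0 T → ∀ n : ℕ, ContDiff ℝ n (p t) := fun ht n =>
    (h.classical.contDiff_pressure ht).of_le (mod_cast le_top)
  refine ⟨hcl, ?_, fun n => ?_, fun n => ?_, fun n => ?_, ?_⟩
  · -- the datum
    funext x
    simp [h.initial]
  · -- `v ∈ L^∞_s H^n_x`
    obtain ⟨C, hC⟩ := h.sobolev n
    refine ⟨‖c‖₊ ^ 2 * C, fun s hs => ?_⟩
    have hcs := hmem hs
    have heq : (fun x => c • u (c * s) x) = c • u (c * s) := rfl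
    rw [heq]
    exact lintegral_iteratedFDeriv_const_smul_le (hsm_u hcs n) c (hC _ hcs)
  · -- `∂ₛv ∈ L^∞_s H^n_x`
    obtain ⟨C, hC⟩ := h.sobolev_dt n
    refine ⟨‖c * c‖₊ ^ 2 * C, fun s hs => ?_⟩
    have hcs := hmem hs
    rw [hdt' s]
    exact lintegral_iteratedFDeriv_const_smul_le (hsm_dt hcs n) (c * c) (hC _ hcs)
  · -- `q ∈ L^∞_s H^n_x`
    obtain ⟨C, hC⟩ := h.sobolev_p n
    refine ⟨‖c ^ 2‖₊ ^ 2 * C, fun s hs => ?_⟩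
    have hcs := hmem hs
    have heq : (fun x => c ^ 2 * p (c * s) x) = (c ^ 2) • p (c * s) := by
      funext x; simp [smul_eq_mul]
    rw [heq]
    exact lintegral_iteratedFDeriv_const_smul_le (hsm_p hcs n) (c ^ 2) (hC _ hcs)
  · -- `v ∈ C([0, T/c]; L²)`
    refine ⟨fun s hs => ?_, fun s₀ hs₀ => ?_⟩
    · show MemLp (c • u (c * s)) 2 volume
      exact (h.continuousL2.1 (c * s) (hmem hs)).const_smul c
    · have hmap : Tendsto (fun s : ℝ => c * s) (𝓝[Icc 0 (T / c)] s₀) (𝓝[Icc 0 T] (c * s₀)) :=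
        (continuous_const.mul continuous_id).continuousWithinAt.tendsto_nhdsWithin
          fun s hs => hmem hs
      have hlim := (h.continuousL2.2 (c * s₀) (hmem hs₀)).comp hmap
      have hlim' := ENNReal.Tendsto.const_mul hlim (a := ‖c‖ₑ) (Or.inr ENNReal.coe_ne_top)
      rw [mul_zero] at hlim'
      refine hlim'.congr fun s => ?_
      have heq : (fun x => c • u (c * s) x) - (fun x => c • u (c * s₀) x) =
          c • (u (c * s) - u (c * s₀)) := by
        funext x
        simp [smul_sub]
      simp only [Function.comp_apply]
      rw [heq, eLpNorm_const_smul]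

end Summit.NavierStokesRegularity.NavierStokesRegularity.Theorems.CertifiedBlowupAxisymBlowup.CompactAmplification

end
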